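import Mathlib
import HarnessLib
import Summits.Ventures.LatticeQCDFlow.Exactness.SphereLuscherSeriesLocalityES

/-!
# The order-`k` generator `T⁽ᵏ⁾_n = −∂̃_n S̃⁽ᵏ⁾` of Lüscher's flow on the lattice of site spheres has receptive field `2(k+1)`, independently of the volume

HONEST FRAMING: exact (Metropolis-corrected) sampling algorithms for lattice gauge theory;
figures of merit are autocorrelation/cost numbers at stated couplings and volumes; no
continuum-physics claim.

Venture `LatticeQCDFlow` (cell pub-lqcd), topic `Exactness`; FANOUT row 7 (`s0-cpn-null`).  NEW
WORK of the cell over Mathlib and the tree's `Exactness/SphereLuscherSeriesLocality.lean` (`nball`,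
`localTerm`, linear footprint growth), `Exactness/SphereLuscherSeriesLocalityES.lean` (the E–S
instance), `Exactness/LatticeSiteLocality.lean` (`sdepOn`) and `Exactness/SphereLOFlowAction.lean`
(`siteGrad` = E–S's `∂̃_n`); nothing is cited as a fact.  Printed counterpart, NAMED ONLY:
M. Lüscher, Commun. Math. Phys. 293 (2010) 899, §4.5 (the generator of the perturbative
trivializing flow is a local composite field at each order); Engel–Schaefer, Comput. Phys. Commun.
182 (2011) 2107, §3 eqs. (14), (16) (the gradient ansatz `ẋ_n = T_n = −∂̃_n S̃`; at order `0`,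
`T_n ∝ p_n` involves only the nearest neighbours of `n`).

## Content

* `nball_symm` — for a SYMMETRIC neighbourhood structure, `m ∈ nball N r n ↔ n ∈ nball N r m`.
* **`siteGrad_eq_of_sdepOn`** / **`siteGrad_eq_zero_of_not_mem'`** — E–S's natural derivative
  `∂̃_n F` of an `A`-supported functional depends only on the sites in `A` (at configurations agreeing
  on `A`, with `n ∈ A`), and vanishes identically for `n ∉ A`.
* **`siteGrad_localSum_eq`** — if `X_m` is supported in `nball N r m` for every anchor `m` (with
  `N` symmetric), then `∂̃_n Σ_m X_m` at site `n` depends only on the sites in `nball N (2r) n`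
  (anchors farther than `r` from `n` do not contribute; the others are supported within `2r` of `n`).
* **`luscher_generator_local_esAction`** — for the Engel–Schaefer action (no self-coupling, adjoint
  pairs): the order-`k` generator `T⁽ᵏ⁾_n = −∂̃_n S̃⁽ᵏ⁾` of the local Lüscher series of
  `SphereLuscherSeriesLocalityES` is determined at site `n` by the sites within coupling-distance
  `2(k+1)` of `n` — A RECEPTIVE FIELD LINEAR IN THE ORDER AND INDEPENDENT OF THE VOLUME `|Λ|`.

NOT CLAIMED: anything at `t > 0`; optimality of `2(k+1)`; bounds on the generator; anything
quantitative.
-/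

noncomputable section

namespace Summit.Ventures.LatticeQCDFlow.Exactness

open Function Set NormedSpace InnerProductSpace Metric
open scoped RealInnerProductSpace ContDiff Gradient

variable {Λ : Type*} {E : Type*} [NormedAddCommGroup E] [InnerProductSpace ℝ E]

/-! ## §1 Symmetric neighbourhood structures -/

section Symm

variable {N : Λ → Set Λ}

/-- **Symmetry of balls**: for a symmetric neighbourhood structure, `m ∈ nball N r n → n ∈ nball N r m`. -/
theorem nball_symm (hN : ∀ a b : Λ, a ∈ N b → b ∈ N a) :
    ∀ (r : ℕ) {n m : Λ}, m ∈ nball N r n → n ∈ nball N r m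
  | 0, n, m, h => by rw [mem_nball_zero] at h ⊢; exact h.symm
  | r + 1, n, m, h => by
      rcases h with h | h
      · exact nball_subset_succ r m (nball_symm hN r h)
      · obtain ⟨m', hm', hmm'⟩ := mem_iUnion₂.1 h
        have h1 : m' ∈ nball N 1 m := subset_nball_one m (hN m m' hmm')
        have h2 : n ∈ nball N r m' := nball_symm hN r hm'
        have h3 := nball_subset_nball_add h1 r h2
        rwa [Nat.add_comm] at h3

end Symm

/-! ## §2 The natural derivative of a supported functional is supported -/

section GradSupport

variable [FiniteDimensional ℝ E] [DecidableEq Λ]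

/-- **`∂̃_n F` only depends on the support of `F`**: if `F ∈ sdepOn A`, `n ∈ A`, and `x, x'` agree
on `A`, then `∂̃_n F(x) = ∂̃_n F(x')`. -/
theorem siteGrad_eq_of_sdepOn {A : Set Λ} {F : (Λ → E) → ℝ} (hF : F ∈ sdepOn A) {n : Λ}
    (hn : n ∈ A) {x x' : Λ → E} (hx : ∀ m ∈ A, x m = x' m) :
    siteGrad n F x = siteGrad n F x' := by
  unfold siteGrad
  have e : (fun y : E => F (update x n (normalize y))) = fun y => F (update x' n (normalize y)) :=
    funext fun y => congrFun (section_eq_of_sdepOn hF hx n) (normalize y)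
  rw [e, hx n hn]

/-- **`∂̃_n F = 0` identically for `n` outside the support of `F`.** -/
theorem siteGrad_eq_zero_of_not_mem' {A : Set Λ} {F : (Λ → E) → ℝ} (hF : F ∈ sdepOn A) {n : Λ}
    (hn : n ∉ A) (x : Λ → E) : siteGrad n F x = 0 := by
  unfold siteGrad
  have e : (fun y : E => F (update x n (normalize y))) = fun _ => F x :=
    funext fun y => congrFun (section_eq_const_of_not_mem hF hn x) (normalize y)
  rw [e, gradient, fderiv_fun_const]
  simp

variable [Fintype Λ]

/-- **`∂̃_n` of a sum of locally supported terms is locally determined.**  If `N` is symmetric and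
each `X m` is a lattice polynomial supported in `nball N r m`, then for configurations `x, x'` with
`x n ≠ 0` agreeing on `nball N (2r) n`, `∂̃_n (Σ_m X m)(x) = ∂̃_n (Σ_m X m)(x')`. -/
theorem siteGrad_localSum_eq {N : Λ → Set Λ} (hN : ∀ a b : Λ, a ∈ N b → b ∈ N a) {r : ℕ}
    {M : Λ → ℕ} {X : Λ → (Λ → E) → ℝ} (hX : ∀ m, X m ∈ polySD Λ E (M m) (nball N r m)) {n : Λ}
    {x x' : Λ → E} (hxn : x n ≠ 0) (hx : ∀ m ∈ nball N (r + r) n, x m = x' m) :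
    siteGrad n (fun z => ∑ m, X m z) x = siteGrad n (fun z => ∑ m, X m z) x' := by
  have hxn' : x' n ≠ 0 := by rwa [hx n (self_mem_nball _ n)] at hxn
  rw [siteGrad_finset_sum Finset.univ hxn
      fun m _ => contDiff_section_of_mem_polyS (hX m).1 _ n 1,
    siteGrad_finset_sum Finset.univ hxn'
      fun m _ => contDiff_section_of_mem_polyS (hX m).1 _ n 1]
  refine Finset.sum_congr rfl fun m _ => ?_
  by_cases hm : n ∈ nball N r m
  · -- anchor within distance r: its support lies within 2r of n
    have hsub : nball N r m ⊆ nball N (r + r) n := nball_subset_nball_add (nball_symm hN r hm) r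
    exact siteGrad_eq_of_sdepOn (hX m).2 hm fun m' hm' => hx m' (hsub hm')
  · rw [siteGrad_eq_zero_of_not_mem' (hX m).2 hm, siteGrad_eq_zero_of_not_mem' (hX m).2 hm]

end GradSupport

/-! ## §3 The Engel–Schaefer generator has receptive field `2(k+1)` -/

section ESGenerator

variable [FiniteDimensional ℝ E] [MeasurableSpace E] [BorelSpace E] [Fintype Λ] [DecidableEq Λ]
  [Nonempty Λ] {U : Λ → Λ → (E →L[ℝ] E)}

omit [FiniteDimensional ℝ E] [MeasurableSpace E] [BorelSpace E] [Fintype Λ] [DecidableEq Λ]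
  [Nonempty Λ] in
/-- Adjoint-pair couplings have symmetric coupling neighbourhoods. -/
theorem couplingNbhd_symm (hUadj : ∀ m n (v w : E), ⟪U m n v, w⟫ = ⟪v, U n m w⟫) (a b : Λ)
    (h : a ∈ couplingNbhd U b) : b ∈ couplingNbhd U a := by
  intro hab
  apply h
  ext v
  refine ext_inner_right ℝ fun w => ?_
  rw [hUadj, hab]
  simp

/-- **THE ORDER-`k` GENERATOR OF THE E–S FLOW IS LOCAL WITH RECEPTIVE FIELD `2(k+1)`.**  For E–S
couplings (no self-coupling, adjoint pairs; `dim E ≥ 2`) there are local terms `X_n⁽ᵏ⁾` and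
constants `ċ_k` as in `exists_local_luscher_series_esAction` (Lüscher's recursion solved by
`S̃⁽ᵏ⁾ = Σ_n X_n⁽ᵏ⁾`, `X_n⁽ᵏ⁾` of degree `≤ 2(k+1)` supported in the radius-`(k+1)` coupling ball of
`n`) such that, IN ADDITION, the generator `T⁽ᵏ⁾_n = −∂̃_n S̃⁽ᵏ⁾` at site `n` takes the same value at
any two configurations with `x_n ≠ 0` agreeing on the radius-`2(k+1)` coupling ball of `n`. -/
theorem luscher_generator_local_esAction (h2 : 2 ≤ Module.finrank ℝ E) (hU0 : ∀ n, U n n = 0)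
    (hUadj : ∀ m n (v w : E), ⟪U m n v, w⟫ = ⟪v, U n m w⟫) (κ S₀ : ℝ) :
    ∃ (X : ℕ → Λ → (Λ → E) → ℝ) (c : ℕ → ℝ),
      (∀ k n, X k n ∈ polySD Λ E (2 * (k + 1)) (nball (couplingNbhd U) (k + 1) n)) ∧
      (∀ ξ : Λ → sphere (0 : E) 1,
        -∑ j, siteLaplacian j (fun x => ∑ n, X 0 n x) (fun m => (ξ m : E)) =
          esAction κ S₀ U (fun m => (ξ m : E)) + c 0) ∧
      (∀ k, ∀ ξ : Λ → sphere (0 : E) 1,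
        -∑ j, siteLaplacian j (fun x => ∑ n, X (k + 1) n x) (fun m => (ξ m : E)) =
          -(∑ j, ⟪siteGrad j (esAction κ S₀ U) (fun m => (ξ m : E)),
              siteGrad j (fun x => ∑ n, X k n x) (fun m => (ξ m : E))⟫) + c (k + 1)) ∧
      (∀ k n (x x' : Λ → E), x n ≠ 0 →
        (∀ m ∈ nball (couplingNbhd U) (k + 1 + (k + 1)) n, x m = x' m) →
          -siteGrad n (fun z => ∑ m, X k m z) x = -siteGrad n (fun z => ∑ m, X k m z) x') := by
  obtain ⟨X, c, hmem, h0, hs⟩ := exists_local_luscher_series_esAction h2 hU0 hUadj κ S₀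
  refine ⟨X, c, hmem, h0, hs, fun k n x x' hxn hx => ?_⟩
  rw [siteGrad_localSum_eq (couplingNbhd_symm hUadj) (fun m => hmem k m) hxn hx]

end ESGenerator

end Summit.Ventures.LatticeQCDFlow.Exactness

end
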